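import Mathlib.Analysis.Calculus.Deriv.MeanValue
import Mathlib.Analysis.Calculus.Deriv.Shift
import Literature.MathematicalPhysics.QuantumLattice.GinibreDoublingProofs
import Literature.MathematicalPhysics.QuantumLattice.XYGriffithsBLUProofs
import Literature.MathematicalPhysics.QuantumLattice.GibbsLinearResponse
import Literature.MathematicalPhysics.QuantumLattice.ApproximatingHamiltonianProofs
import HarnessLib

/-!
# BLU 2016 Theorem 1 (truncated Schwinger and Duhamel functions) and Corollary 2 for cone observables

Companion of `XYGriffithsBLU.lean` / `XYGriffithsBLUProofs.lean` (which discharges the vendored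
special case `benassiLeesUeltschi2016_cor2` by the integrated route). Source: C. Benassi,
B. Lees, D. Ueltschi, *Correlation inequalities for the quantum XY model*, J. Stat. Phys. 164
(2016) 1157–1166 = arXiv:1510.03215 (held; §1 = p0003, §3 = p0005 read). Here we prove, in the
doubled-system vocabulary of `GinibreDoubling.lean` / `GinibreDoublingProofs.lean` (BLU §3,
Lemmas 6–8, `ginibre_trace_sub_nonneg`), the statements the fact file lists as NOT vendored, in
Ginibre's cone form (hypotheses "`U X₊ U†`, `U X₋ U†` entrywise `≥ 0` in the good basis"; the cone
contains the `Sˣ_x` and is closed under products, sums and nonnegative scalars,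
`ginibreCone_siteSpin_zero`, `ginibreCone_mul`, `ginibreCone_add`, `ginibreCone_smul`,
`ginibreCone_sum` — so it contains all `Π_{x∈A} Sˣ_x` and BLU's multi-spin couplings):

* `schwinger_sub_nonneg` — **BLU Theorem 1, first inequality, at fixed `s ∈ [0,1]`**: for a
  Hermitian `H` with `(-H)₊` in the cone and observables `a, b` with `a₋, b₋` in the cone,
  `⟨a ; b⟩_s - ⟨a⟩⟨b⟩ = Z⁻¹ Tr(a e^{-sβH} b e^{-(1-s)βH}) - ⟨a⟩⟨b⟩ ≥ 0` (Lemma 6 + positivity of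
  the doubled trace, exactly the printed proof);
* `re_duhamel_sub_nonneg` — the same integrated over `s`: `Re[(a, b)_Duh - ⟨a⟩⟨b⟩] ≥ 0` for the
  Duhamel two-point function `Matrix.duhamel` of `DuhamelTwoPoint.lean` (the identity displayed
  after Cor. 2 in the paper);
* `re_gibbsState_le_of_sub` — **BLU Corollary 2 (first inequality)** by the paper's route:
  the derivative of `t ↦ Re ⟨O⟩_{β,H-tD}` is `β Re[(O, D)_Duh - ⟨O⟩⟨D⟩] ≥ 0` (Kubo–Duhamel linear
  response, `Matrix.hasDerivAt_gibbsState_add_smul_real` of `GibbsLinearResponse.lean`) and the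
  mean value theorem (`monotoneOn_of_deriv_nonneg`), whenever `D₊, D₋, O₋` lie in the cone;
* the spin-½ XY model `xyPairFieldHamiltonian G K₀ K₁ h₀ h₁` (nonnegative coefficients) fits:
  `(-H)₊` is in the cone (`Sˣ`-bonds and fields lie in Ginibre's cone; for the `Sʸ`-bonds
  `(Sʸ_x Sʸ_y)₊ = ½((Sʸ_x)₊(Sʸ_y)₊ + (Sʸ_x)₋(Sʸ_y)₋)` with BOTH `(Sʸ)₋ ≤ 0` — BLU's parity remark),
  and raising `K₀ ≤ K₀'`, `h₀ ≤ h₀'` subtracts the cone element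
  `D = Σ_e (K₀'-K₀)_e ½(SˣSˣ+SˣSˣ)_e + Σ_x (h₀'-h₀)_x Sˣ_x`; hence
  `xy_schwinger_sub_nonneg`, `xy_re_duhamel_sub_nonneg` (Theorem 1 for the model, all cone
  observables) and `xy_re_gibbsState_le` (Corollary 2, first inequality, for every cone
  observable `O`, e.g. any `Π_{x∈B} Sˣ_x`; the vendored fact is the case `O ∈ {Sˣ_x, Sˣ_xSˣ_y}`).

The second inequalities of Thm. 1 / Cor. 2 (`Π_B S²`, sign `≤ 0`) and the `S = 1` Theorem 3 are
not treated here.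

## References

* C. Benassi, B. Lees, D. Ueltschi, J. Stat. Phys. 164 (2016) 1157 = arXiv:1510.03215, Thm. 1,
  Cor. 2 and its one-line proof (the identity displayed after it), §3. [BenassiLeesUeltschi2016]
* O. Bratteli, D. W. Robinson, *Operator Algebras and QSM II* (1997), §5.4.1 (linear response).
  [BratteliRobinsonII1997]
-/

noncomputable section

namespace Literature.MathematicalPhysics.QuantumLattice

open Matrix Complex
open scoped Kronecker ComplexOrder

/-! ### From the doubled trace to Schwinger functions, the Duhamel function, and BLU Cor. 2 -/

section GibbsMonotone

open MeasureTheory intervalIntegral Set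

variable {Λ : Type*} [Fintype Λ] [DecidableEq Λ]

/-- The Gibbs weight `e^{-tH}` as the exponential of the nonnegative multiple `t` of `-H`. [folklore] -/
theorem gibbsWeight_eq_exp_smul_neg (t : ℝ) (H : Op Λ 2) :
    gibbsWeight t H = NormedSpace.exp ((t : ℂ) • (-H)) := by
  rw [gibbsWeight, smul_neg, neg_smul]

/-- The Duhamel two-point function is odd in its second argument. [folklore] -/
theorem duhamel_neg_right {n : Type*} [Fintype n] [DecidableEq n] (β : ℝ) (H a b : Matrix n n ℂ) :
    duhamel β H a (-b) = -duhamel β H a b := by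
  rw [duhamel, duhamel, ← mul_neg, ← intervalIntegral.integral_neg]
  congr 1
  refine intervalIntegral.integral_congr fun s _ => ?_
  simp only [Matrix.mul_neg, Matrix.neg_mul, trace_neg]

/-- **BLU Theorem 1 (first inequality) at fixed `s`, in the tree's Gibbs-state vocabulary.**
For a Hermitian `H` with `U (-H)₊ U† ≥ 0` entrywise, observables `a, b` with `U a₋ U†, U b₋ U† ≥ 0`
entrywise, `β ≥ 0` and `s ∈ [0, 1]`:
`⟨a ; b⟩_s - ⟨a⟩⟨b⟩ = Z⁻¹ Tr(a e^{-sβH} b e^{-(1-s)βH}) - ⟨a⟩⟨b⟩ ≥ 0`.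
[cite: BenassiLeesUeltschi2016, Thm. 1 (with Lemma 6)] -/
theorem schwinger_sub_nonneg {H a b : Op Λ 2} (hHh : H.IsHermitian)
    (hH : ∀ i j, 0 ≤ ginibreConj Λ (dblPlus Λ (-H)) i j)
    (ha : ∀ i j, 0 ≤ ginibreConj Λ (dblMinus Λ a) i j)
    (hb : ∀ i j, 0 ≤ ginibreConj Λ (dblMinus Λ b) i j) {β s : ℝ} (hβ : 0 ≤ β)
    (hs0 : 0 ≤ s) (hs1 : s ≤ 1) :
    0 ≤ (partitionFn β H)⁻¹ *
          (a * gibbsWeight (s * β) H * b * gibbsWeight ((1 - s) * β) H).trace -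
        gibbsState β H a * gibbsState β H b := by
  set W := gibbsWeight (s * β) H with hW
  set W' := gibbsWeight ((1 - s) * β) H with hW'
  have hWW' : W * W' = gibbsWeight β H := by
    rw [hW, hW', Matrix.gibbsWeight_mul_gibbsWeight]; congr 1; ring
  have hW'W : W' * W = gibbsWeight β H := by
    rw [hW, hW', Matrix.gibbsWeight_mul_gibbsWeight]; congr 1; ring
  have hcore := ginibre_trace_sub_nonneg hH ha hb
    (Complex.zero_le_real.mpr (mul_nonneg hs0 hβ))
    (Complex.zero_le_real.mpr (mul_nonneg (sub_nonneg.mpr hs1) hβ))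
  rw [← gibbsWeight_eq_exp_smul_neg, ← gibbsWeight_eq_exp_smul_neg, ← hW, ← hW'] at hcore
  have hga : gibbsState β H a = (partitionFn β H)⁻¹ * (a * W * W').trace := by
    rw [gibbsState_apply, Matrix.mul_assoc, hWW', trace_mul_comm]
  have hgb : gibbsState β H b = (partitionFn β H)⁻¹ * (W * b * W').trace := by
    rw [gibbsState_apply, trace_mul_cycle W b W', hW'W]
  have hZW : (W * W').trace = partitionFn β H := by rw [hWW']; rfl
  have hZ0 : partitionFn β H ≠ 0 := (partitionFn_pos β hHh).ne'
  have hrew : (partitionFn β H)⁻¹ * (a * W * b * W').trace -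
      (partitionFn β H)⁻¹ * (a * W * W').trace * ((partitionFn β H)⁻¹ * (W * b * W').trace) =
      (partitionFn β H)⁻¹ * (partitionFn β H)⁻¹ *
        ((a * W * b * W').trace * (W * W').trace - (a * W * W').trace * (W * b * W').trace) := by
    rw [hZW]
    field_simp
  rw [hga, hgb, hrew]
  refine mul_nonneg ?_ hcore
  rw [hHh.partitionFn_eq_ofReal, ← Complex.ofReal_inv, ← Complex.ofReal_mul]
  exact Complex.zero_le_real.mpr (mul_self_nonneg _)

/-- **BLU Theorem 1 integrated over `s` (the Duhamel form).** Under the hypotheses of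
`schwinger_sub_nonneg`, `Re[(a, b)_Duh - ⟨a⟩⟨b⟩] ≥ 0`, where
`(a, b)_Duh = Z⁻¹ ∫₀¹ Tr(a e^{-sβH} b e^{-(1-s)βH}) ds`.
[cite: BenassiLeesUeltschi2016, Thm. 1 (with the identity displayed after Cor. 2)] -/
theorem re_duhamel_sub_nonneg {H a b : Op Λ 2} (hHh : H.IsHermitian)
    (hH : ∀ i j, 0 ≤ ginibreConj Λ (dblPlus Λ (-H)) i j)
    (ha : ∀ i j, 0 ≤ ginibreConj Λ (dblMinus Λ a) i j)
    (hb : ∀ i j, 0 ≤ ginibreConj Λ (dblMinus Λ b) i j) {β : ℝ} (hβ : 0 ≤ β) :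
    0 ≤ (duhamel β H a b - gibbsState β H a * gibbsState β H b).re := by
  set f : ℝ → ℂ := fun s => (partitionFn β H)⁻¹ *
      (a * gibbsWeight (s * β) H * b * gibbsWeight ((1 - s) * β) H).trace -
    gibbsState β H a * gibbsState β H b with hf
  have hcont : Continuous f :=
    (continuous_const.mul (continuous_trace_duhamel_integrand β H a b)).sub continuous_const
  have hint : IntervalIntegrable
      (fun s : ℝ => (a * gibbsWeight (s * β) H * b * gibbsWeight ((1 - s) * β) H).trace)
      volume 0 1 :=
    (continuous_trace_duhamel_integrand β H a b).intervalIntegrable 0 1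
  have hrepr : duhamel β H a b - gibbsState β H a * gibbsState β H b = ∫ s in (0 : ℝ)..1, f s := by
    rw [hf, intervalIntegral.integral_sub (hint.const_mul _) intervalIntegrable_const,
      intervalIntegral.integral_const_mul, intervalIntegral.integral_const, sub_zero, one_smul,
      duhamel]
  rw [hrepr, ← Complex.reCLM_apply (∫ s in (0 : ℝ)..1, f s),
    ← ContinuousLinearMap.intervalIntegral_comp_comm _ (hcont.intervalIntegrable 0 1)]
  refine intervalIntegral.integral_nonneg zero_le_one fun s hs => ?_
  rw [Complex.reCLM_apply]
  exact (Complex.nonneg_iff.mp (schwinger_sub_nonneg hHh hH ha hb hβ hs.1 hs.2)).1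

/-- The derivative of `u ↦ Re ⟨O⟩_{β, H + uV}` at any real `u = t` (linear response at the
shifted Hamiltonian `H + tV`). [cite: BratteliRobinsonII1997, §5.4.1] -/
theorem hasDerivAt_re_gibbsState_add_smul {H V : Op Λ 2} (hH : H.IsHermitian) (hV : V.IsHermitian)
    (β : ℝ) (O : Op Λ 2) (t : ℝ) :
    HasDerivAt (fun u : ℝ => (gibbsState β (H + (u : ℂ) • V) O).re)
      (-(β : ℂ) * (duhamel β (H + (t : ℂ) • V) O V -
        gibbsState β (H + (t : ℂ) • V) O * gibbsState β (H + (t : ℂ) • V) V)).re t := by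
  have hHt : (H + (t : ℂ) • V).IsHermitian := hH.add (isHermitian_real_smul hV t)
  have hZ := (partitionFn_pos β hHt).ne'
  have h0 := hasDerivAt_gibbsState_add_smul_real β hZ V O
  rw [show (0 : ℝ) = t - t by ring] at h0
  have h1 := HasDerivAt.comp_sub_const t t h0
  have h2 : HasDerivAt (fun u : ℝ => gibbsState β (H + (u : ℂ) • V) O)
      (-(β : ℂ) * (duhamel β (H + (t : ℂ) • V) O V -
        gibbsState β (H + (t : ℂ) • V) O * gibbsState β (H + (t : ℂ) • V) V)) t := by
    refine h1.congr_of_eventuallyEq (Filter.Eventually.of_forall fun u => ?_)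
    show gibbsState β (H + (u : ℂ) • V) O = gibbsState β (H + (t : ℂ) • V + ((u - t : ℝ) : ℂ) • V) O
    congr 2
    rw [add_assoc, ← add_smul]
    push_cast
    ring_nf
  have h3 := Complex.reCLM.hasFDerivAt.comp_hasDerivAt t h2
  rw [Complex.reCLM_apply] at h3
  exact h3.congr_of_eventuallyEq (Filter.Eventually.of_forall fun u => rfl)

/-- **BLU Corollary 2 (first inequality), integrated: Griffiths–Ginibre monotonicity.** Let `H`
and `D` be Hermitian, with `U (-H)₊ U†`, `U D₊ U†`, `U D₋ U†` and `U O₋ U†` entrywise nonnegative in the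
good basis, and `β ≥ 0`. Then `Re ⟨O⟩_{β, H} ≤ Re ⟨O⟩_{β, H - D}`: along the segment
`t ↦ H - tD` the derivative of `Re ⟨O⟩` is `β Re[(O, D)_Duh - ⟨O⟩⟨D⟩] ≥ 0` (linear response and
Theorem 1 at `H - tD`, whose `-(H - tD)₊ = (-H)₊ + t D₊` stays entrywise nonnegative for `t ≥ 0`).
[cite: BenassiLeesUeltschi2016, Cor. 2 (and the identity displayed after it)] -/
theorem re_gibbsState_le_of_sub {H D O : Op Λ 2} (hHh : H.IsHermitian) (hDh : D.IsHermitian)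
    (hH : ∀ i j, 0 ≤ ginibreConj Λ (dblPlus Λ (-H)) i j)
    (hDp : ∀ i j, 0 ≤ ginibreConj Λ (dblPlus Λ D) i j)
    (hDm : ∀ i j, 0 ≤ ginibreConj Λ (dblMinus Λ D) i j)
    (hO : ∀ i j, 0 ≤ ginibreConj Λ (dblMinus Λ O) i j) {β : ℝ} (hβ : 0 ≤ β) :
    (gibbsState β H O).re ≤ (gibbsState β (H - D) O).re := by
  set f : ℝ → ℝ := fun u => (gibbsState β (H + (u : ℂ) • (-D)) O).re with hf
  have hderiv : ∀ t : ℝ, HasDerivAt f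
      (-(β : ℂ) * (duhamel β (H + (t : ℂ) • (-D)) O (-D) -
        gibbsState β (H + (t : ℂ) • (-D)) O * gibbsState β (H + (t : ℂ) • (-D)) (-D))).re t :=
    fun t => hasDerivAt_re_gibbsState_add_smul hHh hDh.neg β O t
  have hmono : MonotoneOn f (Icc 0 1) := by
    refine monotoneOn_of_deriv_nonneg (convex_Icc 0 1)
      (fun t _ => (hderiv t).continuousAt.continuousWithinAt)
      (fun t _ => (hderiv t).differentiableAt.differentiableWithinAt) fun t ht => ?_
    rw [interior_Icc] at ht
    rw [(hderiv t).deriv, duhamel_neg_right, map_neg]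
    have hHt : (H + (t : ℂ) • (-D)).IsHermitian := hHh.add (isHermitian_real_smul hDh.neg t)
    have hHtgood : ∀ i j, 0 ≤ ginibreConj Λ (dblPlus Λ (-(H + (t : ℂ) • (-D)))) i j := by
      rw [smul_neg, ← sub_eq_add_neg, neg_sub, sub_eq_neg_add, map_add, map_add, map_smul, map_smul]
      exact entrywise_nonneg_add hH (entrywise_nonneg_smul hDp (Complex.zero_le_real.mpr ht.1.le))
    have key := re_duhamel_sub_nonneg hHt hHtgood hO hDm hβ
    have hrew : -(β : ℂ) * (-duhamel β (H + (t : ℂ) • (-D)) O D -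
        gibbsState β (H + (t : ℂ) • (-D)) O * -gibbsState β (H + (t : ℂ) • (-D)) D) =
        (β : ℂ) * (duhamel β (H + (t : ℂ) • (-D)) O D -
          gibbsState β (H + (t : ℂ) • (-D)) O * gibbsState β (H + (t : ℂ) • (-D)) D) := by ring
    rw [hrew, Complex.re_ofReal_mul]
    exact mul_nonneg hβ key
  have h01 := hmono (left_mem_Icc.mpr zero_le_one) (right_mem_Icc.mpr zero_le_one) zero_le_one
  have h0 : f 0 = (gibbsState β H O).re := by
    simp only [hf, Complex.ofReal_zero, zero_smul, add_zero]
  have h1 : f 1 = (gibbsState β (H - D) O).re := by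
    simp only [hf, Complex.ofReal_one, one_smul, sub_eq_add_neg]
  rwa [h0, h1] at h01

end GibbsMonotone

/-! ### The spin-½ XY model in Ginibre's cone: BLU Theorem 1 and Corollary 2 for the model -/

section XYModel

variable {Λ : Type*} [Fintype Λ] [DecidableEq Λ]

/-- The symmetrised bond `½(Sˣ_x Sˣ_y + Sˣ_y Sˣ_x)` lies in Ginibre's cone.
[cite: BenassiLeesUeltschi2016, §3 (proof of Thm. 1)] -/
theorem ginibreCone_spinBond_zero (x y : Λ) :
    (∀ i j, 0 ≤ ginibreConj Λ (dblPlus Λ (spinBond 1 0 x y)) i j) ∧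
      ∀ i j, 0 ≤ ginibreConj Λ (dblMinus Λ (spinBond 1 0 x y)) i j := by
  unfold spinBond
  exact ginibreCone_smul (ginibreCone_add
    (ginibreCone_mul (ginibreCone_siteSpin_zero x) (ginibreCone_siteSpin_zero y))
    (ginibreCone_mul (ginibreCone_siteSpin_zero y) (ginibreCone_siteSpin_zero x)))
    one_half_nonneg_complex

/-- **`(Sʸ_x Sʸ_y)₊ ≥ 0` in the good basis**: `(ab)₊ = ½(a₊b₊ + a₋b₋)` with `a₊, b₊ ≥ 0` and
`a₋, b₋ ≤ 0` (the two signs cancel: BLU's "the number of `S³₋` is even").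
[cite: BenassiLeesUeltschi2016, §3 (proof of Thm. 1)] -/
theorem entrywise_nonneg_ginibreConj_dblPlus_siteSpin_one_mul (x y : Λ) :
    ∀ i j, 0 ≤ ginibreConj Λ (dblPlus Λ (siteSpin 1 x 1 * siteSpin 1 y 1)) i j := by
  rw [dblPlus_mul, map_add, map_smul, map_smul, map_mul, map_mul]
  exact entrywise_nonneg_add
    (entrywise_nonneg_smul (entrywise_nonneg_mul
      (entrywise_nonneg_ginibreConj_dblPlus_siteSpin_one x)
      (entrywise_nonneg_ginibreConj_dblPlus_siteSpin_one y)) inv_two_nonneg_complex)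
    (entrywise_nonneg_smul (entrywise_nonneg_mul_of_nonpos
      (entrywise_nonneg_neg_ginibreConj_dblMinus_siteSpin_one x)
      (entrywise_nonneg_neg_ginibreConj_dblMinus_siteSpin_one y)) inv_two_nonneg_complex)

/-- The symmetrised bond `½(Sʸ_x Sʸ_y + Sʸ_y Sʸ_x)` has `(·)₊ ≥ 0` in the good basis.
[cite: BenassiLeesUeltschi2016, §3 (proof of Thm. 1)] -/
theorem entrywise_nonneg_ginibreConj_dblPlus_spinBond_one (x y : Λ) :
    ∀ i j, 0 ≤ ginibreConj Λ (dblPlus Λ (spinBond 1 1 x y)) i j := by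
  unfold spinBond
  exact entrywise_nonneg_ginibreConj_map_smul _ (entrywise_nonneg_ginibreConj_map_add _
    (entrywise_nonneg_ginibreConj_dblPlus_siteSpin_one_mul x y)
    (entrywise_nonneg_ginibreConj_dblPlus_siteSpin_one_mul y x)) one_half_nonneg_complex

/-- **The XY Hamiltonian is in Ginibre's `(·)₊`-cone**: for nonnegative couplings and fields,
`U (-H)₊ U†` is entrywise nonnegative, `H = xyPairFieldHamiltonian G K₀ K₁ h₀ h₁`.
[cite: BenassiLeesUeltschi2016, §3 (proof of Thm. 1)] -/
theorem entrywise_nonneg_ginibreConj_dblPlus_neg_xyPairFieldHamiltonian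
    (G : SimpleGraph Λ) [DecidableRel G.Adj] {K₀ K₁ : Sym2 Λ → ℝ} {h₀ h₁ : Λ → ℝ}
    (hK₀ : ∀ e, 0 ≤ K₀ e) (hK₁ : ∀ e, 0 ≤ K₁ e) (hh₀ : ∀ x, 0 ≤ h₀ x) (hh₁ : ∀ x, 0 ≤ h₁ x) :
    ∀ i j, 0 ≤ ginibreConj Λ (dblPlus Λ (-xyPairFieldHamiltonian G K₀ K₁ h₀ h₁)) i j := by
  rw [xyPairFieldHamiltonian, neg_sub, sub_neg_eq_add]
  refine entrywise_nonneg_ginibreConj_map_add _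
    (entrywise_nonneg_ginibreConj_map_sum _ _ fun x _ => entrywise_nonneg_ginibreConj_map_add _
      (entrywise_nonneg_ginibreConj_map_smul _ (ginibreCone_siteSpin_zero x).1
        (Complex.zero_le_real.mpr (hh₀ x)))
      (entrywise_nonneg_ginibreConj_map_smul _ (entrywise_nonneg_ginibreConj_dblPlus_siteSpin_one x)
        (Complex.zero_le_real.mpr (hh₁ x))))
    (entrywise_nonneg_ginibreConj_map_sum _ _ fun e _ => ?_)
  induction e using Sym2.ind with
  | h x y =>
    rw [Sym2.lift_mk]
    exact entrywise_nonneg_ginibreConj_map_add _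
      (entrywise_nonneg_ginibreConj_map_smul _ (ginibreCone_spinBond_zero x y).1
        (Complex.zero_le_real.mpr (hK₀ _)))
      (entrywise_nonneg_ginibreConj_map_smul _ (entrywise_nonneg_ginibreConj_dblPlus_spinBond_one x y)
        (Complex.zero_le_real.mpr (hK₁ _)))

/-- **Raising direction-`0` couplings and fields subtracts an element of Ginibre's cone**:
`H(K₀', h₀') = H(K₀, h₀) - D` with
`D = Σ_e (K₀' - K₀)_e ½(SˣSˣ + SˣSˣ)_e + Σ_x (h₀' - h₀)_x Sˣ_x`. [cite: BenassiLeesUeltschi2016, §1] -/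
theorem xyPairFieldHamiltonian_eq_sub (G : SimpleGraph Λ) [DecidableRel G.Adj]
    (K₀ K₀' K₁ : Sym2 Λ → ℝ) (h₀ h₀' h₁ : Λ → ℝ) :
    xyPairFieldHamiltonian G K₀' K₁ h₀' h₁ = xyPairFieldHamiltonian G K₀ K₁ h₀ h₁ -
      ((∑ e ∈ G.edgeFinset, ((K₀' e - K₀ e : ℝ) : ℂ) •
          Sym2.lift ⟨fun x y => spinBond 1 0 x y, fun x y => (spinBond_comm 1 0 x y).symm⟩ e) +
        ∑ x : Λ, ((h₀' x - h₀ x : ℝ) : ℂ) • siteSpin 1 x 0) := by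
  unfold xyPairFieldHamiltonian
  have hE : ∀ e ∈ G.edgeFinset,
      Sym2.lift ⟨fun x y => (K₀' e : ℂ) • spinBond (Λ := Λ) 1 0 x y + (K₁ e : ℂ) • spinBond 1 1 x y,
        fun x y => by simp only [spinBond_comm]⟩ e =
      Sym2.lift ⟨fun x y => (K₀ e : ℂ) • spinBond (Λ := Λ) 1 0 x y + (K₁ e : ℂ) • spinBond 1 1 x y,
        fun x y => by simp only [spinBond_comm]⟩ e +
      ((K₀' e - K₀ e : ℝ) : ℂ) • Sym2.lift ⟨fun x y => spinBond 1 0 x y, fun x y => (spinBond_comm 1 0 x y).symm⟩ e := by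
    intro e _
    induction e using Sym2.ind with
    | h x y =>
      simp only [Sym2.lift_mk]
      push_cast
      module
  have hV : ∀ x ∈ (Finset.univ : Finset Λ),
      (h₀' x : ℂ) • siteSpin (Λ := Λ) 1 x 0 + (h₁ x : ℂ) • siteSpin 1 x 1 =
      (h₀ x : ℂ) • siteSpin (Λ := Λ) 1 x 0 + (h₁ x : ℂ) • siteSpin 1 x 1 +
        ((h₀' x - h₀ x : ℝ) : ℂ) • siteSpin 1 x 0 := by
    intro x _
    push_cast
    module
  rw [Finset.sum_congr rfl hE, Finset.sum_congr rfl hV, Finset.sum_add_distrib,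
    Finset.sum_add_distrib]
  abel

/-- The increment `D` lies in Ginibre's cone when `K₀ ≤ K₀'` and `h₀ ≤ h₀'`.
[cite: BenassiLeesUeltschi2016, §3] -/
theorem ginibreCone_increment (G : SimpleGraph Λ) [DecidableRel G.Adj]
    {K₀ K₀' : Sym2 Λ → ℝ} {h₀ h₀' : Λ → ℝ} (hK : ∀ e, K₀ e ≤ K₀' e) (hh : ∀ x, h₀ x ≤ h₀' x) :
    (∀ i j, 0 ≤ ginibreConj Λ (dblPlus Λ
      ((∑ e ∈ G.edgeFinset, ((K₀' e - K₀ e : ℝ) : ℂ) •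
          Sym2.lift ⟨fun x y => spinBond 1 0 x y, fun x y => (spinBond_comm 1 0 x y).symm⟩ e) +
        ∑ x : Λ, ((h₀' x - h₀ x : ℝ) : ℂ) • siteSpin 1 x 0)) i j) ∧
    ∀ i j, 0 ≤ ginibreConj Λ (dblMinus Λ
      ((∑ e ∈ G.edgeFinset, ((K₀' e - K₀ e : ℝ) : ℂ) •
          Sym2.lift ⟨fun x y => spinBond 1 0 x y, fun x y => (spinBond_comm 1 0 x y).symm⟩ e) +
        ∑ x : Λ, ((h₀' x - h₀ x : ℝ) : ℂ) • siteSpin 1 x 0)) i j := by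
  refine ginibreCone_add (ginibreCone_sum _ fun e _ => ginibreCone_smul ?_
      (Complex.zero_le_real.mpr (sub_nonneg.mpr (hK e))))
    (ginibreCone_sum _ fun x _ => ginibreCone_smul (ginibreCone_siteSpin_zero x)
      (Complex.zero_le_real.mpr (sub_nonneg.mpr (hh x))))
  induction e using Sym2.ind with
  | h x y => exact ginibreCone_spinBond_zero x y

/-- The increment `D` is Hermitian. [folklore] -/
theorem increment_isHermitian (G : SimpleGraph Λ) [DecidableRel G.Adj]
    (K₀ K₀' : Sym2 Λ → ℝ) (h₀ h₀' : Λ → ℝ) :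
    ((∑ e ∈ G.edgeFinset, ((K₀' e - K₀ e : ℝ) : ℂ) •
          Sym2.lift ⟨fun x y => spinBond 1 0 x y, fun x y => (spinBond_comm 1 0 x y).symm⟩ e) +
        ∑ x : Λ, ((h₀' x - h₀ x : ℝ) : ℂ) • siteSpin 1 x 0 : Op Λ 2).IsHermitian := by
  refine IsHermitian.add ?_ ?_
  · rw [IsHermitian, conjTranspose_sum]
    refine Finset.sum_congr rfl fun e _ => ?_
    induction e using Sym2.ind with
    | h x y => exact (isHermitian_real_smul (spinBond_isHermitian 1 0 x y) _).eq
  · rw [IsHermitian, conjTranspose_sum]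
    exact Finset.sum_congr rfl fun x _ => (isHermitian_real_smul (siteSpin_isHermitian 1 x 0) _).eq

/-- **BLU Theorem 1 (first inequality) for the spin-½ XY model with pair and field couplings**,
at fixed `s ∈ [0, 1]`: for `H = xyPairFieldHamiltonian G K₀ K₁ h₀ h₁` with nonnegative
coefficients, `β ≥ 0`, and observables `a, b` whose `a₋, b₋` lie in Ginibre's cone (all
`Π_{x∈A} Sˣ_x` and their nonnegative combinations do), the truncated Schwinger function is
nonnegative: `Z⁻¹ Tr(a e^{-sβH} b e^{-(1-s)βH}) - ⟨a⟩⟨b⟩ ≥ 0`. Printed for general multi-spin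
couplings `J¹_A, J²_A ≥ 0`; here pairs and singletons. [cite: BenassiLeesUeltschi2016, Thm. 1] -/
theorem xy_schwinger_sub_nonneg (G : SimpleGraph Λ) [DecidableRel G.Adj] {K₀ K₁ : Sym2 Λ → ℝ}
    {h₀ h₁ : Λ → ℝ} (hK₀ : ∀ e, 0 ≤ K₀ e) (hK₁ : ∀ e, 0 ≤ K₁ e) (hh₀ : ∀ x, 0 ≤ h₀ x)
    (hh₁ : ∀ x, 0 ≤ h₁ x) {a b : Op Λ 2} (ha : ∀ i j, 0 ≤ ginibreConj Λ (dblMinus Λ a) i j)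
    (hb : ∀ i j, 0 ≤ ginibreConj Λ (dblMinus Λ b) i j) {β s : ℝ} (hβ : 0 ≤ β) (hs0 : 0 ≤ s)
    (hs1 : s ≤ 1) :
    0 ≤ (partitionFn β (xyPairFieldHamiltonian G K₀ K₁ h₀ h₁))⁻¹ *
          (a * gibbsWeight (s * β) (xyPairFieldHamiltonian G K₀ K₁ h₀ h₁) * b *
            gibbsWeight ((1 - s) * β) (xyPairFieldHamiltonian G K₀ K₁ h₀ h₁)).trace -
        gibbsState β (xyPairFieldHamiltonian G K₀ K₁ h₀ h₁) a *
          gibbsState β (xyPairFieldHamiltonian G K₀ K₁ h₀ h₁) b :=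
  schwinger_sub_nonneg (GinibreXY.xyPairFieldHamiltonian_isHermitian G K₀ K₁ h₀ h₁)
    (entrywise_nonneg_ginibreConj_dblPlus_neg_xyPairFieldHamiltonian G hK₀ hK₁ hh₀ hh₁) ha hb hβ
    hs0 hs1

/-- **BLU Theorem 1 (first inequality), Duhamel form, for the spin-½ XY model**: under the
hypotheses of `xy_schwinger_sub_nonneg`, `Re[(a, b)_Duh - ⟨a⟩⟨b⟩] ≥ 0`, i.e. (by the identity
displayed after Cor. 2) `∂/∂J ⟨a⟩ ≥ 0` for the coupling `J` of `b`.
[cite: BenassiLeesUeltschi2016, Thm. 1 (with the identity displayed after Cor. 2)] -/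
theorem xy_re_duhamel_sub_nonneg (G : SimpleGraph Λ) [DecidableRel G.Adj] {K₀ K₁ : Sym2 Λ → ℝ}
    {h₀ h₁ : Λ → ℝ} (hK₀ : ∀ e, 0 ≤ K₀ e) (hK₁ : ∀ e, 0 ≤ K₁ e) (hh₀ : ∀ x, 0 ≤ h₀ x)
    (hh₁ : ∀ x, 0 ≤ h₁ x) {a b : Op Λ 2} (ha : ∀ i j, 0 ≤ ginibreConj Λ (dblMinus Λ a) i j)
    (hb : ∀ i j, 0 ≤ ginibreConj Λ (dblMinus Λ b) i j) {β : ℝ} (hβ : 0 ≤ β) :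
    0 ≤ (duhamel β (xyPairFieldHamiltonian G K₀ K₁ h₀ h₁) a b -
        gibbsState β (xyPairFieldHamiltonian G K₀ K₁ h₀ h₁) a *
          gibbsState β (xyPairFieldHamiltonian G K₀ K₁ h₀ h₁) b).re :=
  re_duhamel_sub_nonneg (GinibreXY.xyPairFieldHamiltonian_isHermitian G K₀ K₁ h₀ h₁)
    (entrywise_nonneg_ginibreConj_dblPlus_neg_xyPairFieldHamiltonian G hK₀ hK₁ hh₀ hh₁) ha hb hβ

/-- **BLU Corollary 2 (first inequality) for the spin-½ XY model and every cone observable**: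
for nonnegative couplings and fields, raising the direction-`0` couplings `K₀ ≤ K₀'` and fields
`h₀ ≤ h₀'` does not lower `Re ⟨O⟩_β` for any observable `O` with `O₋` in Ginibre's cone (e.g. any
`Π_{x∈B} Sˣ_x`; the vendored fact `benassiLeesUeltschi2016_cor2` — discharged in
`XYGriffithsBLUProofs.lean` — is the case `O ∈ {Sˣ_x, Sˣ_x Sˣ_y}`).
[cite: BenassiLeesUeltschi2016, Cor. 2] -/
theorem xy_re_gibbsState_le (G : SimpleGraph Λ) [DecidableRel G.Adj]
    {K₀ K₀' K₁ : Sym2 Λ → ℝ} {h₀ h₀' h₁ : Λ → ℝ} (hK₀ : ∀ e, 0 ≤ K₀ e ∧ K₀ e ≤ K₀' e)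
    (hK₁ : ∀ e, 0 ≤ K₁ e) (hh₀ : ∀ x, 0 ≤ h₀ x ∧ h₀ x ≤ h₀' x) (hh₁ : ∀ x, 0 ≤ h₁ x)
    {O : Op Λ 2} (hO : ∀ i j, 0 ≤ ginibreConj Λ (dblMinus Λ O) i j) {β : ℝ} (hβ : 0 ≤ β) :
    (gibbsState β (xyPairFieldHamiltonian G K₀ K₁ h₀ h₁) O).re ≤
      (gibbsState β (xyPairFieldHamiltonian G K₀' K₁ h₀' h₁) O).re := by
  have hD := ginibreCone_increment G (fun e => (hK₀ e).2) (fun x => (hh₀ x).2)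
  rw [xyPairFieldHamiltonian_eq_sub G K₀ K₀' K₁ h₀ h₀' h₁]
  exact re_gibbsState_le_of_sub (GinibreXY.xyPairFieldHamiltonian_isHermitian G K₀ K₁ h₀ h₁)
    (increment_isHermitian G K₀ K₀' h₀ h₀')
    (entrywise_nonneg_ginibreConj_dblPlus_neg_xyPairFieldHamiltonian G (fun e => (hK₀ e).1) hK₁
      (fun x => (hh₀ x).1) hh₁) hD.1 hD.2 hO hβ

end XYModel

end Literature.MathematicalPhysics.QuantumLattice
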